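import Summits.AtomisticToContinuum.HydrodynamicLimit.Theorems.AntiMazurCoboundariesCellForecastPressureDecayCellLawFactorises
import HarnessLib

/-!
# S2d · kinematic assembly, piece 5: pairs are exchangeable under the position law
# (registered sub-goal `stub_kinematicAssembly_pairExchangeable` of stub `stub_kinematicAssembly`, crux line
# `enskog-compensator-martingale`, crux `CellForecastPressureDecay`, stmt-AtomisticToContinuum-13915)

In the equal-time Enskog kinematics (`KinematicRates σ`, stub S2d) the main term is, after conditioning on the
velocities (`CellLawFactorises`, S2a), a sum over ordered pairs `i ≠ j` of `∫ φᵢⱼ(xᵢ − xⱼ) posLaw(dx)` with a pair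
functional `φᵢⱼ` that DEPENDS on the pair through its velocities (`stub_kinematicAssembly_mainTerm`), whereas the
pair statistics `ContactStatistics` (S2c) control the double sum `∑_{i≠j} ∫ φ(xᵢ − xⱼ)` for ONE test function `φ`.
The bridge is exchangeability: the uniform hard-core law `posLaw σ L n` is invariant under relabelling the spheres,
so `∫ φ(xᵢ − xⱼ) dposLaw` does not depend on the ordered pair `i ≠ j`, and the double sum of S2c is `n(n − 1)` times
any one of its terms. This file proves:

* `measurePreserving_relabel` — relabelling `x ↦ x ∘ e` preserves Lebesgue measure on `(ℝ³)ⁿ`;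
* `posLaw_relabel` — and the position law (the admissible set is relabelling invariant);
* `stub_kinematicAssembly_pairExchangeable` (registered) — `∫ φ(xᵢ − xⱼ) = ∫ φ(x_{i'} − x_{j'})` for `i ≠ j`,
  `i' ≠ j'`;
* `sum_integral_posLaw_pair` — `∑_{i≠j} ∫ φ(xᵢ − xⱼ) = n(n − 1) ∫ φ(x_{i₀} − x_{j₀})`.

References: D. Ruelle, *Statistical Mechanics: Rigorous Results* (1969), §4.1 (symmetry of the canonical
correlation functions); folklore.
-/

noncomputable section

open MeasureTheory ProbabilityTheory Set Filter
open scoped ENNReal BigOperators InnerProductSpace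
open Literature.Analysis.FluidPDE Literature.MathematicalPhysics.KineticTheory

namespace Summit.AtomisticToContinuum.HydrodynamicLimit.Theorems.EnskogCompensator

/-- **Relabelling preserves Lebesgue measure** on `(ℝ³)ⁿ`: `x ↦ (k ↦ x (e k))` for a permutation `e`. [folklore] -/
theorem measurePreserving_relabel (n : ℕ) (e : Equiv.Perm (Fin n)) :
    MeasurePreserving (fun x : Fin n → V3 => fun k => x (e k)) volume volume := by
  have hT : Measurable (fun x : Fin n → V3 => fun k => x (e k)) :=
    measurable_pi_lambda _ fun k => measurable_pi_apply (e k)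
  refine ⟨hT, ?_⟩
  rw [volume_pi]
  refine (Measure.pi_eq fun s hs => ?_).symm
  rw [Measure.map_apply hT (MeasurableSet.univ_pi hs)]
  have hpre : (fun x : Fin n → V3 => fun k => x (e k)) ⁻¹' Set.pi univ s = Set.pi univ fun m => s (e.symm m) := by
    ext x
    simp only [mem_preimage, mem_univ_pi]
    constructor
    · intro h m; simpa using h (e.symm m)
    · intro h k; simpa using h (e k)
  rw [hpre, Measure.pi_pi]
  exact Equiv.prod_comp e.symm (fun k => volume (s k))

/-- The admissible set is invariant under relabelling. [folklore] -/
theorem preimage_relabel_posAdmissible (σ L : ℝ) (n : ℕ) (e : Equiv.Perm (Fin n)) :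
    (fun x : Fin n → V3 => fun k => x (e k)) ⁻¹' posAdmissible σ L n = posAdmissible σ L n := by
  ext x
  simp only [mem_preimage, mem_posAdmissible]
  constructor
  · rintro ⟨h1, h2⟩
    refine ⟨fun i j hij => ?_, fun i k => by simpa using h2 (e.symm i) k⟩
    have := h1 (e.symm i) (e.symm j) (fun h => hij (e.symm.injective h))
    simpa using this
  · rintro ⟨h1, h2⟩
    exact ⟨fun i j hij => h1 (e i) (e j) (fun h => hij (e.injective h)), fun i k => h2 (e i) k⟩

/-- **The position law is exchangeable**: relabelling preserves `posLaw σ L n`. [cite: Ruelle1969, §4.1] -/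
theorem posLaw_relabel (σ L : ℝ) (n : ℕ) (e : Equiv.Perm (Fin n)) :
    MeasurePreserving (fun x : Fin n → V3 => fun k => x (e k)) (posLaw σ L n) (posLaw σ L n) := by
  have h := (measurePreserving_relabel n e).restrict_preimage (measurableSet_posAdmissible σ L n)
  rw [preimage_relabel_posAdmissible] at h
  rw [posLaw]
  exact h.smul_measure _

/-- Relabelling as a measurable equivalence of `(ℝ³)ⁿ`. [folklore] -/
theorem exists_measurableEquiv_relabel (n : ℕ) (e : Equiv.Perm (Fin n)) :
    ∃ T : (Fin n → V3) ≃ᵐ (Fin n → V3), ∀ x, T x = fun k => x (e k) :=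
  ⟨{ toFun := fun x k => x (e k),
     invFun := fun x k => x (e.symm k),
     left_inv := fun x => by funext k; simp,
     right_inv := fun x => by funext k; simp,
     measurable_toFun := measurable_pi_lambda _ fun k => measurable_pi_apply _,
     measurable_invFun := measurable_pi_lambda _ fun k => measurable_pi_apply _ }, fun _ => rfl⟩

/-- For ordered pairs `i ≠ j`, `i' ≠ j'` there is a permutation with `e i' = i`, `e j' = j`. [folklore] -/
theorem exists_perm_pair {n : ℕ} {i j i' j' : Fin n} (hij : i ≠ j) (hij' : i' ≠ j') :
    ∃ e : Equiv.Perm (Fin n), e i' = i ∧ e j' = j := by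
  classical
  set e₁ : Equiv.Perm (Fin n) := Equiv.swap i' i with he₁
  have h1 : e₁ i' = i := Equiv.swap_apply_left _ _
  have h2 : e₁ j' ≠ i := fun h => hij' (e₁.injective (h1.trans h.symm))
  refine ⟨e₁.trans (Equiv.swap (e₁ j') j), ?_, ?_⟩
  · rw [Equiv.trans_apply, h1, Equiv.swap_apply_of_ne_of_ne h2.symm hij]
  · rw [Equiv.trans_apply, Equiv.swap_apply_left]

/-- **Registered sub-goal `stub_kinematicAssembly_pairExchangeable`** (piece of stub `stub_kinematicAssembly`, S2d,
of the line `enskog-compensator-martingale`): under the uniform hard-core position law of the cell, the law of the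
relative position `xᵢ − xⱼ` is the same for every ordered pair `i ≠ j`: `∫ φ(xᵢ − xⱼ) dposLaw = ∫ φ(x_{i'} − x_{j'}) dposLaw`
(any `φ`; both sides are `0` for non-integrable `φ`). [cite: Ruelle1969, §4.1] -/
theorem stub_kinematicAssembly_pairExchangeable : ∀ (σ L : ℝ) (n : ℕ) (φ : V3 → ℝ) (i j i' j' : Fin n), i ≠ j → i' ≠ j' →
    ∫ x, φ (x i - x j) ∂(posLaw σ L n) = ∫ x, φ (x i' - x j') ∂(posLaw σ L n) := by
  intro σ L n φ i j i' j' hij hij'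
  obtain ⟨e, hei, hej⟩ := exists_perm_pair hij hij'
  obtain ⟨T, hT⟩ := exists_measurableEquiv_relabel n e
  have hmp : MeasurePreserving T (posLaw σ L n) (posLaw σ L n) := by
    have h := posLaw_relabel σ L n e
    have hcoe : (⇑T : (Fin n → V3) → (Fin n → V3)) = fun x => fun k => x (e k) := funext hT
    rwa [← hcoe] at h
  have h := hmp.integral_comp' (fun y : Fin n → V3 => φ (y i' - y j'))
  simp only [hT, hei, hej] at h
  exact h

/-- **The double sum of the pair statistics is `n(n − 1)` times one term**:
`∑ᵢ ∑ⱼ [i ≠ j] ∫ φ(xᵢ − xⱼ) dposLaw = n (n − 1) ∫ φ(x_{i₀} − x_{j₀}) dposLaw` for any ordered pair `i₀ ≠ j₀`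
(the left side is literally the sum controlled by `ContactStatistics`). [cite: Ruelle1969, §4.1] -/
theorem sum_integral_posLaw_pair (σ L : ℝ) {n : ℕ} (φ : V3 → ℝ) {i₀ j₀ : Fin n} (h₀ : i₀ ≠ j₀) :
    (∑ i : Fin n, ∑ j : Fin n, if i = j then 0 else ∫ x, φ (x i - x j) ∂(posLaw σ L n)) =
      (n : ℝ) * (n - 1) * ∫ x, φ (x i₀ - x j₀) ∂(posLaw σ L n) := by
  classical
  set c : ℝ := ∫ x, φ (x i₀ - x j₀) ∂(posLaw σ L n) with hc
  have hterm : ∀ i j : Fin n, (if i = j then 0 else ∫ x, φ (x i - x j) ∂(posLaw σ L n)) =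
      if i = j then 0 else c := by
    intro i j
    split_ifs with hij
    · rfl
    · exact stub_kinematicAssembly_pairExchangeable σ L n φ i j i₀ j₀ hij h₀
  simp only [hterm]
  have hinner : ∀ i : Fin n, (∑ j : Fin n, if i = j then (0 : ℝ) else c) = (n - 1) * c := by
    intro i
    rw [Finset.sum_ite, Finset.sum_const_zero, zero_add, Finset.sum_const, nsmul_eq_mul]
    congr 1
    have : (Finset.univ.filter fun j : Fin n => ¬ i = j) = Finset.univ.erase i := by
      ext j; simp [eq_comm]
    rw [this, Finset.card_erase_of_mem (Finset.mem_univ i), Finset.card_univ, Fintype.card_fin,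
      Nat.cast_sub (Fin.pos i), Nat.cast_one]
  simp only [hinner, Finset.sum_const, Finset.card_univ, Fintype.card_fin, nsmul_eq_mul]
  ring

end Summit.AtomisticToContinuum.HydrodynamicLimit.Theorems.EnskogCompensator

end
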